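import Mathlib
import Summits.Ventures.CertifiedArithmetic.LowPrec.OptSSEWindow

/-!
# Opt / T9 — the admissible band of the amax-threshold family: below `(T + G) u` the clipping scale `u` is never worse than the non-clipping scale `2u`, elementwise and for every monotone block loss; strict SSE converse above `14 u + (k-1) u / 8` (E2M1)

HONEST FRAMING: certified error envelopes and provably optimal rounding/accumulation schemes for
low-precision formats under stated cost models; every table by two implementations; no hardware or
vendor claims.

fp4/DESIGN.md §4, T9 (idea-1 seat), statement shapes `lean/idea1/T9Shapes.lean` (idea-1 gen5, ask 1d), in
the units of `OptTwoCandidates` / `OptSearchGainSSE` / `OptSSEWindow`: magnitude grid `B ⊂ ℕ` with top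
`T = 2 Tm` (`T, Tm ∈ B`), `err hB s y` = distance from `y` to the saturating round-to-nearest grid `s • B`,
`u` = the HALF (clipping) candidate, `2u` = the non-clipping candidate (top `2 T u`). The new format datum is
the GAP `G`: every grid point above `Tm` is `≥ Tm + G` (E2M1 `(T, Tm, G) = (12, 6, 2)`: the points above `6`
are `8, 12`; E2M3 `(60, 30, 2)`; E3M2 `(448, 224, 32)`), so that on `(T u, (T + G) u]` the fine error `y - T u`
(clipping) equals the coarse error (the nearest coarse points are `T u = 2 u Tm` and `≥ 2 u (Tm + G)`).

* `half_le_ceil_elem` — T9(a) PER ELEMENT, generic: `0 ≤ y ≤ (T + G) u → err u y ≤ err (2u) y` (grid nesting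
  `halving_le` on `[0, T u]`, the gap computation above on `(T u, (T + G) u]`).
* `half_le_ceil_block` — T9(a) BLOCK form for EVERY monotone per-element loss `ℓ` and weights `γ ≥ 0`
  (SSE, weighted SSE = OUT-D / KL-F-diagonal, L1 = OUT-∞(∞), L∞ via `Finset.sup'` is the `k = 1` case
  termwise): if every element is `≤ (T + G) u` then `∑ γ i * ℓ (err u (x i)) ≤ ∑ γ i * ℓ (err (2u) (x i))`
  — the dominance half of DESIGN's admissible band (threshold `q = (T + G)/2 = 7` weakly dominates every
  `q ∈ [6, 7)` block by block); `half_le_ceil_sse` — the `blockSSE` instance.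
* `ceil_lt_half_sse` — T9(c), the STRICT CONVERSE for unweighted SSE, generic: if the block maximum `a ≥ T u`
  satisfies `(k - 1) u² < (a - T u)² - (a - 2 u N)²` for some grid point `N ∈ B`, then `SSE(2u) < SSE(u)`
  (the maximum alone loses `(a - T u)² - err(2u, a)² ≥ (a - T u)² - (a - 2 u N)²`, every other element gains
  at most `u²` by Theorem S6's per-element bound `sq_gain_le`).
* E2M1 instances (`half_le_ceil_elem_e2m1`, `half_le_ceil_block_e2m1`, `half_le_ceil_sse_e2m1`,
  `ceil_lt_half_sse_e2m1` — with `N = 8`, `(a - 12u)² - (a - 16u)² = 8 u (a - 14 u)`, so the hypothesis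
  `14 u + (k-1) u/8 < a` is exactly the gain condition; the hand-off's `a < 20 u` is not needed), the E2M3 /
  E3M2 per-element instances (`half_le_ceil_elem_e2m3`: `y ≤ 62 u`; `half_le_ceil_elem_e3m2`: `y ≤ 480 u`),
  and, in namespace `T9`, theorems whose TYPES are the bodies of the hand-off's five `Prop`s verbatim
  (`T9.elemHalfLeCeilE2M1`, `T9.blockHalfLeCeilE2M1`, `T9.sseHalfLeCeilE2M1`, `T9.sseCeilLtHalfE2M1`,
  `T9.elemHalfLeCeilGeneric` — the last for every format datum `(B, T, Tm, G)`).
Proof text: fp4/DESIGN.md §4 T9 (idea-1) and OPTIMA.md (opt seat, pub-lowprec); this file is the Lean port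
asked for in DESIGN ask 1d. Nothing here depends on an input law.
-/

namespace Summit.Ventures.CertifiedArithmetic.LowPrec.Opt

section T9Band

variable {K : Type*} [Field K] [LinearOrder K] [IsStrictOrderedRing K]
variable {B : Finset ℕ} (hB : B.Nonempty)

/-- **T9(a), per element, generic.** Below `(T + G) u` the half (clipping) grid `u • B` is never worse than
the non-clipping grid `(2u) • B`. -/
theorem half_le_ceil_elem {T Tm G : ℕ} (hT : T ∈ B) (hle : ∀ n ∈ B, n ≤ T)
    (hT2 : 2 * Tm = T) (hdouble : ∀ n ∈ B, 2 * n ≤ T → 2 * n ∈ B)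
    (hgap : ∀ n ∈ B, Tm < n → Tm + G ≤ n) {u y : K} (hu : 0 < u)
    (hy : y ≤ ((T + G : ℕ) : K) * u) : err hB u y ≤ err hB (2 * u) y := by
  by_cases hyT : y ≤ (T : K) * u
  · exact halving_le hB hT hdouble hu hyT
  · push Not at hyT
    rw [err_eq_sub_top hB hT hle hu.le hyT.le]
    unfold err gridDist
    apply Finset.le_inf'
    intro v hv
    obtain ⟨n, hn, rfl⟩ := Finset.mem_image.mp hv
    have hTK : ((2 * Tm : ℕ) : K) = T := by rw [hT2]
    push_cast at hTK
    have hG0 : (0 : K) ≤ G := Nat.cast_nonneg G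
    have hyK : y ≤ ((T : K) + G) * u := by push_cast at hy; exact hy
    by_cases hnm : n ≤ Tm
    · have hnK : (n : K) ≤ Tm := by exact_mod_cast hnm
      have h1 : 2 * u * (n : K) ≤ (T : K) * u := by nlinarith
      rw [abs_of_nonneg (by linarith)]
      linarith
    · push Not at hnm
      have h1K : (Tm : K) + G ≤ n := by exact_mod_cast hgap n hn hnm
      have h1 : ((T : K) + 2 * G) * u ≤ 2 * u * (n : K) := by nlinarith
      rw [abs_of_nonpos (by nlinarith)]
      nlinarith

/-- **T9(a), block form, generic, for EVERY monotone per-element loss `ℓ` and weights `γ ≥ 0`** (SSE: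
`ℓ t = t²`, `γ ≡ 1`; weighted SSE = OUT-D / KL-F-diagonal; L1 = OUT-∞(∞): `ℓ = id`): if every element is
`≤ (T + G) u` then the half candidate `u` is never worse than the non-clipping candidate `2u` on that block. -/
theorem half_le_ceil_block {T Tm G : ℕ} (hT : T ∈ B) (hle : ∀ n ∈ B, n ≤ T)
    (hT2 : 2 * Tm = T) (hdouble : ∀ n ∈ B, 2 * n ≤ T → 2 * n ∈ B)
    (hgap : ∀ n ∈ B, Tm < n → Tm + G ≤ n) {k : ℕ} (x : Fin k → K) {u : K} (γ : Fin k → K)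
    (ℓ : K → K) (hu : 0 < u) (hx : ∀ i, x i ≤ ((T + G : ℕ) : K) * u) (hγ : ∀ i, 0 ≤ γ i)
    (hℓ : Monotone ℓ) :
    ∑ i, γ i * ℓ (err hB u (x i)) ≤ ∑ i, γ i * ℓ (err hB (2 * u) (x i)) := by
  apply Finset.sum_le_sum
  intro i _
  exact mul_le_mul_of_nonneg_left
    (hℓ (half_le_ceil_elem hB hT hle hT2 hdouble hgap hu (hx i))) (hγ i)

/-- **T9(a), block SSE instance, generic** (`blockSSE` of `OptSearchGainSSE`). -/
theorem half_le_ceil_sse {T Tm G : ℕ} (hT : T ∈ B) (hle : ∀ n ∈ B, n ≤ T)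
    (hT2 : 2 * Tm = T) (hdouble : ∀ n ∈ B, 2 * n ≤ T → 2 * n ∈ B)
    (hgap : ∀ n ∈ B, Tm < n → Tm + G ≤ n) {k : ℕ} (x : Fin k → K) {u : K} (hu : 0 < u)
    (hx : ∀ i, x i ≤ ((T + G : ℕ) : K) * u) :
    blockSSE hB u x ≤ blockSSE hB (2 * u) x := by
  unfold blockSSE
  apply Finset.sum_le_sum
  intro i _
  have h0 : 0 ≤ err hB u (x i) := gridDist_nonneg _ _
  have h := half_le_ceil_elem hB hT hle hT2 hdouble hgap hu (hx i)
  nlinarith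

/-- **T9(c), the strict converse for unweighted SSE, generic.** If the block maximum `a ≥ T u` satisfies
`(k - 1) u² < (a - T u)² - (a - 2 u N)²` for some grid point `N ∈ B` (a coarse point `2 u N` near `a`), then the
non-clipping scale `2u` is STRICTLY better than the half candidate `u` in block SSE: the maximum alone loses
at least `(a - T u)² - (a - 2 u N)²`, each of the other `k - 1` elements gains at most `u²` (`sq_gain_le`). -/
theorem ceil_lt_half_sse {T Tm L Lm N : ℕ} (hT : T ∈ B) (hle : ∀ n ∈ B, n ≤ T) (hTm : Tm ∈ B)
    (hT2 : 2 * Tm = T) (hL : L ∈ B) (hLm : Lm ∈ B) (hL2 : 2 * Lm = L)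
    (hAB : ∀ n ∈ B, L ≤ 2 * n → 2 * n ≤ T → 2 * n ∈ B)
    (hBA : ∀ n ∈ B, L ≤ n → n ≤ T → ∃ m ∈ B, 2 * m = n)
    (hlow : ∀ u y : K, 0 < u → 0 ≤ y → y ≤ (L : K) * u → err hB (2 * u) y ≤ u) (hN : N ∈ B)
    {k : ℕ} (x : Fin k → K) {u a : K} (hu : 0 < u) (hx0 : ∀ i, 0 ≤ x i) (i₀ : Fin k)
    (hi₀ : x i₀ = a) (hTa : (T : K) * u ≤ a)
    (hgain : ((k : K) - 1) * u ^ 2 < (a - (T : K) * u) ^ 2 - (a - 2 * u * (N : K)) ^ 2) :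
    blockSSE hB (2 * u) x < blockSSE hB u x := by
  have hk1 : 1 ≤ k := Fin.pos i₀
  -- the maximum
  have htopf : err hB u a = a - (T : K) * u := err_eq_sub_top hB hT hle hu.le hTa
  have hc0 : 0 ≤ err hB (2 * u) a := gridDist_nonneg _ _
  have hc1 : err hB (2 * u) a ≤ |a - 2 * u * (N : K)| :=
    err_le_of_near_abs hB (n := N) hN
      (by linarith [neg_abs_le (a - 2 * u * (N : K))]) (by linarith [le_abs_self (a - 2 * u * (N : K))])
  have htopc : err hB (2 * u) a ^ 2 ≤ (a - 2 * u * (N : K)) ^ 2 := by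
    rw [← sq_abs (a - 2 * u * (N : K))]
    exact pow_le_pow_left₀ hc0 hc1 2
  -- the other elements
  have hrest : ∀ i, err hB (2 * u) (x i) ^ 2 ≤ err hB u (x i) ^ 2 + u ^ 2 := by
    intro i
    have h := (sq_gain_le hB hT hle hTm hT2 hL hLm hL2 hAB hBA hlow hu (hx0 i) 0 (y := x i)).1
    simp only [pow_zero, div_one] at h
    linarith
  have hsum : ∑ i ∈ Finset.univ.erase i₀, err hB (2 * u) (x i) ^ 2 ≤
      ∑ i ∈ Finset.univ.erase i₀, err hB u (x i) ^ 2 + ((k : K) - 1) * u ^ 2 := by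
    have h := Finset.sum_le_sum (fun i (_ : i ∈ Finset.univ.erase i₀) => hrest i)
    rw [Finset.sum_add_distrib, Finset.sum_const, Finset.card_erase_of_mem (Finset.mem_univ _),
      Finset.card_univ, Fintype.card_fin, nsmul_eq_mul, Nat.cast_sub hk1, Nat.cast_one] at h
    exact h
  have e1 : blockSSE hB u x = err hB u a ^ 2 + ∑ i ∈ Finset.univ.erase i₀, err hB u (x i) ^ 2 := by
    unfold blockSSE
    rw [← Finset.add_sum_erase _ _ (Finset.mem_univ i₀), hi₀]
  have e2 : blockSSE hB (2 * u) x =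
      err hB (2 * u) a ^ 2 + ∑ i ∈ Finset.univ.erase i₀, err hB (2 * u) (x i) ^ 2 := by
    unfold blockSSE
    rw [← Finset.add_sum_erase _ _ (Finset.mem_univ i₀), hi₀]
  rw [e1, e2, htopf]
  linarith

/-! ### Instances: E2M1 in the hand-off's quantifier shapes, E2M3 / E3M2 per element -/

/-- T9(a) per element, E2M1 (`(T, Tm, G) = (12, 6, 2)`): `y ≤ 14 u`. -/
theorem half_le_ceil_elem_e2m1 {u y : K} (hu : 0 < u) (hy : y ≤ 14 * u) :
    err e2m1Lo_ne u y ≤ err e2m1Lo_ne (2 * u) y :=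
  half_le_ceil_elem e2m1Lo_ne (T := 12) (Tm := 6) (G := 2) (by decide) (by decide)
    (by norm_num) (by decide) (by decide) hu (by push_cast; linarith)

/-- T9(a) per element, E2M3 (`(60, 30, 2)`): `y ≤ 62 u`. -/
theorem half_le_ceil_elem_e2m3 {u y : K} (hu : 0 < u) (hy : y ≤ 62 * u) :
    err e2m3Lo_ne u y ≤ err e2m3Lo_ne (2 * u) y :=
  half_le_ceil_elem e2m3Lo_ne (T := 60) (Tm := 30) (G := 2) (by decide) (by decide)
    (by norm_num) (by decide) (by decide) hu (by push_cast; linarith)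

/-- T9(a) per element, E3M2 (`(448, 224, 32)`): `y ≤ 480 u`. -/
theorem half_le_ceil_elem_e3m2 {u y : K} (hu : 0 < u) (hy : y ≤ 480 * u) :
    err e3m2Lo_ne u y ≤ err e3m2Lo_ne (2 * u) y :=
  half_le_ceil_elem e3m2Lo_ne (T := 448) (Tm := 224) (G := 32) (by decide) (by decide)
    (by norm_num) (by decide) (by decide) hu (by push_cast; linarith)

/-- T9(a) block form, E2M1, every monotone loss and nonnegative weights. -/
theorem half_le_ceil_block_e2m1 {k : ℕ} (x : Fin k → K) {u : K} (γ : Fin k → K) (ℓ : K → K)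
    (hu : 0 < u) (hx : ∀ i, x i ≤ 14 * u) (hγ : ∀ i, 0 ≤ γ i) (hℓ : Monotone ℓ) :
    ∑ i, γ i * ℓ (err e2m1Lo_ne u (x i)) ≤ ∑ i, γ i * ℓ (err e2m1Lo_ne (2 * u) (x i)) :=
  half_le_ceil_block e2m1Lo_ne (T := 12) (Tm := 6) (G := 2) (by decide) (by decide)
    (by norm_num) (by decide) (by decide) x γ ℓ hu (fun i => by push_cast; linarith [hx i]) hγ hℓ

/-- T9(a) block SSE, E2M1. -/
theorem half_le_ceil_sse_e2m1 {k : ℕ} (x : Fin k → K) {u : K} (hu : 0 < u) (hx : ∀ i, x i ≤ 14 * u) :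
    blockSSE e2m1Lo_ne u x ≤ blockSSE e2m1Lo_ne (2 * u) x :=
  half_le_ceil_sse e2m1Lo_ne (T := 12) (Tm := 6) (G := 2) (by decide) (by decide)
    (by norm_num) (by decide) (by decide) x hu (fun i => by push_cast; linarith [hx i])

/-- T9(c) strict SSE converse, E2M1: `14 u + (k-1) u / 8 < a` (window position `> 7/2 + (k-1)/32`) makes the
non-clipping scale strictly better (`N = 8`: `(a - 12u)² - (a - 16u)² = 8 u (a - 14 u)`). -/
theorem ceil_lt_half_sse_e2m1 {k : ℕ} (x : Fin k → K) {u a : K} (i₀ : Fin k) (hu : 0 < u)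
    (hx0 : ∀ i, 0 ≤ x i) (hi₀ : x i₀ = a) (ha : 14 * u + ((k : K) - 1) * u / 8 < a) :
    blockSSE e2m1Lo_ne (2 * u) x < blockSSE e2m1Lo_ne u x := by
  have hk1 : 1 ≤ k := Fin.pos i₀
  have hk1K : (1 : K) ≤ k := by exact_mod_cast hk1
  have hku : 0 ≤ ((k : K) - 1) * u := mul_nonneg (by linarith) hu.le
  have hTa : ((12 : ℕ) : K) * u ≤ a := by
    push_cast
    have : ((k : K) - 1) * u / 8 ≥ 0 := by positivity
    linarith
  refine ceil_lt_half_sse e2m1Lo_ne (T := 12) (Tm := 6) (L := 4) (Lm := 2) (N := 8) (by decide)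
    (by decide) (by decide) (by norm_num) (by decide) (by decide) (by norm_num) (by decide) (by decide)
    (fun u y hu hy0 hy => e2m1_lowcov hu hy0 (by simpa using hy)) (by decide) x hu hx0 i₀ hi₀ hTa ?_
  push_cast
  have h8 : ((k : K) - 1) * u < 8 * (a - 14 * u) := by linarith
  nlinarith [mul_lt_mul_of_pos_right h8 hu]

end T9Band

/-! ### The hand-off's statement shapes (`lean/idea1/T9Shapes.lean`, idea-1 gen5): each theorem below has as
its TYPE the body of the corresponding `Prop` of the hand-off, verbatim (`T9Shapes.ElemHalfLeCeilE2M1 K` etc.),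
so the port can be checked against the hand-off by textual comparison -/

namespace T9

variable (K : Type*) [Field K] [LinearOrder K] [IsStrictOrderedRing K]

/-- = `T9Shapes.ElemHalfLeCeilE2M1 K` (T9(a) per element, E2M1). -/
theorem elemHalfLeCeilE2M1 :
    ∀ (u y : K), 0 < u → 0 ≤ y → y ≤ 14 * u → err e2m1Lo_ne u y ≤ err e2m1Lo_ne (2 * u) y :=
  fun _ _ hu _ hy => half_le_ceil_elem_e2m1 hu hy

/-- = `T9Shapes.BlockHalfLeCeilE2M1 K` (T9(a) block form, every monotone loss `ℓ`, weights `γ ≥ 0`). -/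
theorem blockHalfLeCeilE2M1 :
    ∀ (k : ℕ) (x : Fin k → K) (u : K) (γ : Fin k → K) (ℓ : K → K),
      0 < u → (∀ i, 0 ≤ x i) → (∀ i, x i ≤ 14 * u) → (∀ i, 0 ≤ γ i) → Monotone ℓ →
        ∑ i, γ i * ℓ (err e2m1Lo_ne u (x i)) ≤ ∑ i, γ i * ℓ (err e2m1Lo_ne (2 * u) (x i)) :=
  fun _ x _ γ ℓ hu _ hx hγ hℓ => half_le_ceil_block_e2m1 x γ ℓ hu hx hγ hℓ

/-- = `T9Shapes.SSEHalfLeCeilE2M1 K` (T9(a), `blockSSE`). -/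
theorem sseHalfLeCeilE2M1 :
    ∀ (k : ℕ) (x : Fin k → K) (u : K), 0 < u → (∀ i, 0 ≤ x i) → (∀ i, x i ≤ 14 * u) →
      blockSSE e2m1Lo_ne u x ≤ blockSSE e2m1Lo_ne (2 * u) x :=
  fun _ x _ hu _ hx => half_le_ceil_sse_e2m1 x hu hx

/-- = `T9Shapes.SSECeilLtHalfE2M1 K` (T9(c), strict SSE converse; the hypotheses `∀ i, x i ≤ a` and
`a < 20 u` of the hand-off are carried but not needed). -/
theorem sseCeilLtHalfE2M1 :
    ∀ (k : ℕ) (x : Fin k → K) (u a : K) (i₀ : Fin k), 0 < u → (∀ i, 0 ≤ x i) → (∀ i, x i ≤ a) →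
      x i₀ = a → 14 * u + ((k : K) - 1) * u / 8 < a → a < 20 * u →
        blockSSE e2m1Lo_ne (2 * u) x < blockSSE e2m1Lo_ne u x :=
  fun _ x _ _ i₀ hu hx0 _ hi₀ ha _ => ceil_lt_half_sse_e2m1 x i₀ hu hx0 hi₀ ha

/-- = `T9Shapes.ElemHalfLeCeilGeneric K B hB T Tm G` (T9 format-generic dominance per element), for EVERY
format datum. -/
theorem elemHalfLeCeilGeneric (B : Finset ℕ) (hB : B.Nonempty) (T Tm G : ℕ) :
    T ∈ B → Tm ∈ B → 2 * Tm = T → (∀ n ∈ B, n ≤ T) → (∀ n ∈ B, 2 * n ≤ T → 2 * n ∈ B) →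
      (∀ n ∈ B, Tm < n → Tm + G ≤ n) →
      ∀ (u y : K), 0 < u → 0 ≤ y → y ≤ ((T + G : ℕ) : K) * u → err hB u y ≤ err hB (2 * u) y :=
  fun hT _ hT2 hle hdouble hgap _ _ hu _ hy => half_le_ceil_elem hB hT hle hT2 hdouble hgap hu hy

end T9

end Summit.Ventures.CertifiedArithmetic.LowPrec.Opt
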